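import Summits.HodgeConjecture.HodgeConjecture.Theorems.R90S6HyperbolicHeckeFLAtPlace         -- ★ (B2d)-AT-PLACE (this seat): the engine `…_of_levi_atPlace`
import Literature.NumberTheory.Rogawski1990.UnitFundamentalLemmaInertLeviClause               -- ★ `isLocalGRegular_conj_iff` (+ ★ `isUnit_levi_of_isLocalGRegular_of_nonsplit`, ★ transport `…_iff_of_isLocalStablyConjH`)
import Literature.NumberTheory.Automorphic.HyperspecialUnitarySatakeTransformAdicCompletion   -- ★ `unramifiedLocalConjDatum_localConjUniformizer`
import Literature.NumberTheory.Automorphic.HyperspecialUnitaryCartanUnique                    -- ★ `exists_v_eq_exp`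
import HarnessLib

/-!
# R90 · S6 «Ch. 14.1–14.5 stable TF» — G5 (2): THE HYPERBOLIC-CELL PAYER `h_HYP` OF THE ONE-FRAME HECKE FUNDAMENTAL LEMMA COMBINATOR
# (`Theorems/R90S6HeckeFLAtFrameHypCell.lean`)

Cell `hodgecm-mathlib`, crux H413 (`stmt-HodgeConjecture-24833`), route of record `HCCMUnconditional`; programme R90-TF, section S6 (base `R90-C14`, dealer R90-C14-plan (g3)),
seat R90-C14-p09 (g2); card G5 (2) dealt by RULINGS #39 (R91) 2026-09-05T04:09:14Z; DAG row E1.3.6.2 → socket `Cruxes/H413/Lines/R90_S6_FloorE1D.lean` :989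
`StubR90ExtE1HeckeFLOneFrame` via the combinator (A) `heckeFLAtFrame_of_cells` (K2E3-p34, ED. C′).  Lane `--kind proof --supports stmt-HodgeConjecture-24833 --as helper`; THEOREMS ONLY
(no definition ∕ instance ∕ notation ∕ named fact ∕ kit ∕ `sorry`); imports = ★ (B2d)-AT-PLACE `R90S6HyperbolicHeckeFLAtPlace` + ★ `UnitFundamentalLemmaInertLeviClause` + ★
`HyperspecialUnitarySatakeTransformAdicCompletion` + ★ `HyperspecialUnitaryCartanUnique` + HarnessLib (Theorems → Theorems ∕ Literature; never `Lines/`).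

## THE PRINT
[Rogawski1990, §4.9 Prop. 4.9.1 (b), (4.9.2), Lemma 4.9.2 pp. 54–56]: `ξ̂_H(f)` is a transfer of `f ∈ ℋ_G`; on the Levi `M` «the stable class and the `κ`-class are single conjugacy
classes», and both sides of (4.3.1) are stable class functions of `γ_H` ((4.1.1) p. 40).

## WHAT IS PROVED (namespace `Summit.HodgeConjecture.HodgeConjecture.R90.S6`)
* **`heckeFLAtFrame_hypCell`** — the `hHYP` binder of (A) `heckeFLAtFrame_of_cells` (per-place measures, ED. C′; the cell = the first disjunct of C3 `gRegular_cells`: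
  `∃ h d′, glDiagonal 2 _ d′ = (h γ_H.1 h⁻¹).val`), CLOSED over: the socket's per-place data and hypotheses at `v` (`νG νH` Haar, `hμω`, `hH′` in the socket's
  `cmConjRingHom` spelling, `νG(U(H′)(𝒪_v)) = 1`, `νH(K_H) = 1`), the good-place guards `hH′w hH′i hμ`, the stub frame + `G`-frame letters of ★ (G4) `exists_socketFrame_three`
  (`T₀ a₀ ha₀ hT₀ eG`, (LEV) `hlev`, (MAT) `hmat`) and the literal `H`-frame of ★ (G4) `exists_socketFrame_two` (`e₂`, (MAT₂) `hmat₂`) — NO other letter ((T-INT), (K-SOC),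
  (hEK), K-law₂ are not needed).  PROOF (40 lines): `y := (h, 1) ∈ H_v`; `γ_H ∼_st yγ_Hy⁻¹` (★ `isLocalStablyConjH_of_isConj_and_conj`), `G`-regularity moves (★ `isLocalGRegular_conj_iff`),
  the Levi units `ha hb h12` (★ `isUnit_levi_of_isLocalGRegular_of_nonsplit`), `m := −ord` of `d′₀,w` (★ `exists_v_eq_exp`), the unramified datum at `w` (★
  `unramifiedLocalConjDatum_localConjUniformizer`), `det H′ ∈ Lˣ` from `hH′w` (`RingHom.map_det`), `hH′` re-spelled (★ `map_cmConjRingHom_eq_map_complexConj`); then ★ (B2d)-AT-PLACE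
  `stableOrbitalIntegralRel_coeff_toVector_eq_finsum_finExplicitDelta_of_levi_atPlace` at `K₃ K₂ :=` the literal levels (`Iff.rfl`, `rfl`), `eA₃ := congr ≫ eG` (`heA₃ := hmat`), `eA₂ := e₂`,
  `hl hr :=` ★ `finExplicitDelta_conj_left_all ∕ _right_all`; the `G`-test function is moved from `congr⁻¹ ≫ (congr ≫ eG)` to `eG` POINTWISE (`ContinuousMulEquiv.trans_apply`,
  `apply_symm_apply`) and by `congrArg` (house rule (a): no `rw` on the socket goal); finally ★ `stableOrbitalIntegralRel_eq_finsum_finExplicitDelta_iff_of_isLocalStablyConjH` transports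
  the clause from `yγ_Hy⁻¹` to `γ_H`.
CONSUMER NOTE (D ED. 6 link ∕ (B)): `h_HYP := heckeFLAtFrame_hypCell L H' μ w hw hv νH νG eG hμω hH hvolG hvolH hH'w hH'i hμ T₀ a₀ ha₀ hT₀ hlev hmat e₂ hmat₂` (per-place `νH νG`;
from families pass `(νH v) (νG v) … (hvolG v) (hvolH v)`).  `maxHeartbeats 800000` ∕ `synthInstance.maxHeartbeats 200000` scoped on the head (one application of the AT-PLACE head).
HONEST LABEL: helper theorem, count-neutral until (A) + ELL-1 + ELL-2 + C3 + D ED. 6 land; proves no printed global statement by itself, discharges no citation.  HC_CM is proved only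
modulo the 7 printed citations (2 remaining named inputs: hLiu418 = stmt-HodgeConjecture-24832, h413 = stmt-HodgeConjecture-24833) until rung 0 closes; REL ≠ ★ ≠ BUILT.

Dedup: `rg heckeFLAtFrame_hypCell lean/` — no hit (2026-09-05T04:20Z).

## References
* [Rogawski1990] J. D. Rogawski, *Automorphic Representations of Unitary Groups in Three Variables*, Ann. of Math. Stud. 123 (1990): §4.9 pp. 54–56; §4.3 (4.3.1) p. 43; §4.1 (4.1.1) p. 40.
* [PlatonovRapinchuk1994] V. Platonov, A. Rapinchuk, *Algebraic Groups and Number Theory*, Academic Press (1994): §5.1; §2.3.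
-/

set_option autoImplicit false
-- the mandated namespace repeats the single-problem summit's segment (`HodgeConjecture.HodgeConjecture`)
set_option linter.dupNamespace false

noncomputable section

open MeasureTheory Measure Set NumberField IsDedekindDomain Matrix
open Literature.NumberTheory.Automorphic Literature.NumberTheory.Automorphic.UnitaryGroup
open Literature.NumberTheory.Automorphic.HermitianLattice Literature.NumberTheory.Automorphic.HermitianLattice.UnramifiedLocalConjDatum
open Literature.NumberTheory.GaloisRepresentations
open Literature.NumberTheory.Rogawski1990
open scoped NNReal ENNReal Matrix MatrixGroups Valued WithZero Topology

namespace Summit.HodgeConjecture.HodgeConjecture.R90.S6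

section HypCell

-- (raised budgets: one application of the instance-laden ★ AT-PLACE head — see that file's ENGINEERING NOTES (c); no search tactic, no `decide`)
set_option maxHeartbeats 800000 in
set_option synthInstance.maxHeartbeats 200000 in
/-- **G5 (2) — THE HYPERBOLIC-CELL PAYER `h_HYP` OF ★ (A) `heckeFLAtFrame_of_cells`.**  At a finite place `v` of `L⁺` non-split (`c • w = w`) and unramified in `L`, with the
socket's per-place data (`νG`, `νH` Haar, `νG(U(H′)(𝒪_v)) = 1`, `νH(K_H) = 1`, the μ-guard `hμω`), the good-place guards (`hH′w hH′i hμ`), the stub frame and the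
`G`-frame with their ★ (G4) letters (`T₀ a₀ ha₀ hT₀ eG`, (LEV) `hlev`, (MAT) `hmat`) and the literal `H`-frame with (MAT₂) (`e₂ hmat₂`): FOR ALL canonical families `mH`
(at `IsLocalGRegular`) and `mG` (at `IsRegularElt`), all `(φ, φ^H)` in Satake-graph position and every `G`-regular `γ_H ∈ H_v` IN THE HYPERBOLIC CELL (`γ_H.1` is
`U(Φ₂)_v`-conjugate to a diagonal `diag(d′₀, d′₁)` — the first disjunct of C3 `gRegular_cells`):
`Φ^st(γ_H, T₂[K₀] ∘ e₂ ∘ fst) = ∑ᶠ c, Δ‴_v(γ_H, out c) · Φ(c, T₃[K₀] ∘ eG)` — the `hHYP` binder of (A) verbatim (per-place measures).  PROOF: conjugate `γ_H` into the Levi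
stratum by `y = (h, 1) ∈ H_v` (★ `isLocalStablyConjH_of_isConj_and_conj`, ★ `isLocalGRegular_conj_iff`; both sides are stable class functions of `γ_H`: ★
`stableOrbitalIntegralRel_eq_finsum_finExplicitDelta_iff_of_isLocalStablyConjH`), read the Levi units `ha hb h12` off `G`-regularity (★ `isUnit_levi_of_isLocalGRegular_of_nonsplit`),
`m := ord_w d′₀` (★ `exists_v_eq_exp`), take the unramified datum at `w` (★ `unramifiedLocalConjDatum_localConjUniformizer`) and `det H′ ∈ Lˣ` from `hH′w`, and apply ★ (B2d)-AT-PLACE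
`…_of_levi_atPlace` at `eA₃ := congr ≫ eG` (so `heA₃ = (MAT)`), `eA₂ := e₂`; finally `congr⁻¹ ≫ (congr ≫ eG) = eG` pointwise on the `G`-test function (`congrArg`, no `rw` on the socket goal).
[cite: Rogawski1990, §4.9 Prop. 4.9.1 (b), (4.9.2), Lemma 4.9.2 pp. 54–56; §4.3 (4.3.1) p. 43; §4.1 (4.1.1) p. 40] [cite: PlatonovRapinchuk1994, §5.1] -/
theorem heckeFLAtFrame_hypCell
    (L : Type) [Field L] [NumberField L] [IsCMField L] (H' : Matrix (Fin 3) (Fin 3) L) (μ : HeckeCharacter L)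
    {v : HeightOneSpectrum (𝓞 ↥(maximalRealSubfield L))} (w : PlacesOver L v)
    (hw : IsCMField.complexConj L • w.1 = w.1) (hv : Algebra.IsUnramifiedIn (𝓞 L) v.asIdeal)
    -- the per-place measurable structures and Haar measures of the socket (ED. C′ of (A))
    [MeasurableSpace ((cmDatum L 2 (Matrix.of fun i j : Fin 2 => if i.val + j.val + 1 = 2 then (1 : L) else 0)).Local v ×
      (cmDatum L 1 (Matrix.of fun i j : Fin 1 => if i.val + j.val + 1 = 1 then (1 : L) else 0)).Local v)]
    [BorelSpace ((cmDatum L 2 (Matrix.of fun i j : Fin 2 => if i.val + j.val + 1 = 2 then (1 : L) else 0)).Local v ×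
      (cmDatum L 1 (Matrix.of fun i j : Fin 1 => if i.val + j.val + 1 = 1 then (1 : L) else 0)).Local v)]
    [MeasurableSpace ((cmDatum L 3 H').Local v)] [BorelSpace ((cmDatum L 3 H').Local v)]
    (νH : Measure ((cmDatum L 2 (Matrix.of fun i j : Fin 2 => if i.val + j.val + 1 = 2 then (1 : L) else 0)).Local v ×
      (cmDatum L 1 (Matrix.of fun i j : Fin 1 => if i.val + j.val + 1 = 1 then (1 : L) else 0)).Local v))
    (νG : Measure ((cmDatum L 3 H').Local v))
    [νH.IsHaarMeasure] [νH.IsMulRightInvariant] [νG.IsHaarMeasure] [νG.IsMulRightInvariant]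
    (eG : (cmDatum L 3 H').Local v ≃ₜ* ↥(unitaryGroupOfForm (galAdicCompletionMap (L := L) (IsCMField.complexConj L) hw) ((StdForm.antidiagonal 3).over (w.1.adicCompletion L))))
    -- Borel structures on the centraliser quotients, instance-generic ((A)'s quadruple)
    [∀ a : ((cmDatum L 2 (Matrix.of fun i j : Fin 2 => if i.val + j.val + 1 = 2 then (1 : L) else 0)).Local v ×
      (cmDatum L 1 (Matrix.of fun i j : Fin 1 => if i.val + j.val + 1 = 1 then (1 : L) else 0)).Local v),
      MeasurableSpace (((cmDatum L 2 (Matrix.of fun i j : Fin 2 => if i.val + j.val + 1 = 2 then (1 : L) else 0)).Local v ×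
      (cmDatum L 1 (Matrix.of fun i j : Fin 1 => if i.val + j.val + 1 = 1 then (1 : L) else 0)).Local v) ⧸ Subgroup.centralizer ({a} : Set ((cmDatum L 2 (Matrix.of fun i j : Fin 2 => if i.val + j.val + 1 = 2 then (1 : L) else 0)).Local v ×
      (cmDatum L 1 (Matrix.of fun i j : Fin 1 => if i.val + j.val + 1 = 1 then (1 : L) else 0)).Local v)))]
    [∀ a : ((cmDatum L 2 (Matrix.of fun i j : Fin 2 => if i.val + j.val + 1 = 2 then (1 : L) else 0)).Local v ×
      (cmDatum L 1 (Matrix.of fun i j : Fin 1 => if i.val + j.val + 1 = 1 then (1 : L) else 0)).Local v),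
      BorelSpace (((cmDatum L 2 (Matrix.of fun i j : Fin 2 => if i.val + j.val + 1 = 2 then (1 : L) else 0)).Local v ×
      (cmDatum L 1 (Matrix.of fun i j : Fin 1 => if i.val + j.val + 1 = 1 then (1 : L) else 0)).Local v) ⧸ Subgroup.centralizer ({a} : Set ((cmDatum L 2 (Matrix.of fun i j : Fin 2 => if i.val + j.val + 1 = 2 then (1 : L) else 0)).Local v ×
      (cmDatum L 1 (Matrix.of fun i j : Fin 1 => if i.val + j.val + 1 = 1 then (1 : L) else 0)).Local v)))]
    [∀ γ : ((cmDatum L 3 H').Local v), MeasurableSpace (((cmDatum L 3 H').Local v) ⧸ Subgroup.centralizer ({γ} : Set ((cmDatum L 3 H').Local v)))]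
    [∀ γ : ((cmDatum L 3 H').Local v), BorelSpace (((cmDatum L 3 H').Local v) ⧸ Subgroup.centralizer ({γ} : Set ((cmDatum L 3 H').Local v)))]
    -- socket hypotheses at `v` (the μ-guard, hermitian `H′` in the socket's spelling, the two unit normalisations)
    (hμω : ∀ x : ideleGroup ↥(maximalRealSubfield L), μ (AdeleRing.ideleBaseChange ↥(maximalRealSubfield L) L x) = quadraticHeckeCharCM L x)
    (hH' : (H'.map (cmConjRingHom L)).transpose = H')
    (hνG : νG (cmLocalIntegralLevel L 3 H' v : Set ((cmDatum L 3 H').Local v)) = 1)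
    (hνH : νH ((((cmLocalIntegralLevel L 2 (Matrix.of fun i j : Fin 2 => if i.val + j.val + 1 = 2 then (1 : L) else 0) v).prod
      (cmLocalIntegralLevel L 1 (Matrix.of fun i j : Fin 1 => if i.val + j.val + 1 = 1 then (1 : L) else 0) v)) :
        Subgroup ((cmDatum L 2 (Matrix.of fun i j : Fin 2 => if i.val + j.val + 1 = 2 then (1 : L) else 0)).Local v ×
          (cmDatum L 1 (Matrix.of fun i j : Fin 1 => if i.val + j.val + 1 = 1 then (1 : L) else 0)).Local v)) :
        Set ((cmDatum L 2 (Matrix.of fun i j : Fin 2 => if i.val + j.val + 1 = 2 then (1 : L) else 0)).Local v ×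
          (cmDatum L 1 (Matrix.of fun i j : Fin 1 => if i.val + j.val + 1 = 1 then (1 : L) else 0)).Local v)) = 1)
    -- good-place guards (`v ∉ Sbad`, ★ (G4) §1)
    (hH'w : IsUnit (placeForm H' w.1)) (hH'i : hH'w.unit ∈ glInt 3 (w.1.adicCompletion L)) (hμ : μ.IsUnramifiedAt w.1)
    -- the stub frame and the `G`-frame with their letters (★ (G4) §2 `exists_socketFrame_three`: (LEV), (MAT))
    (T₀ : GL (Fin 3) (UnitaryGroup.LocalRing L v)) (a₀ : UnitaryGroup.LocalRing L v) (ha₀ : IsUnit a₀)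
    (hT₀ : formCongr (conjLocal L (IsCMField.complexConj L) v) T₀ (H'.map (algebraMap L (UnitaryGroup.LocalRing L v))) =
      a₀ • (Matrix.of fun i j : Fin 3 => if i.val + j.val + 1 = 3 then (1 : L) else 0).map (algebraMap L (UnitaryGroup.LocalRing L v)))
    (hlev : ∀ g : (cmDatum L 3 H').Local v,
      (cmDatumLocalCongr L v T₀ ha₀ hT₀).symm g ∈ cmLocalIntegralLevel L 3 (Matrix.of fun i j : Fin 3 => if i.val + j.val + 1 = 3 then (1 : L) else 0) v ↔
        g ∈ cmLocalIntegralLevel L 3 H' v)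
    (hmat : ∀ g : ↥(unitaryGroupOfForm (conjLocal L (IsCMField.complexConj L) v) (cmLocalForm L 3 v)),
      ((eG (cmDatumLocalCongr L v T₀ ha₀ hT₀ g) :
          ↥(unitaryGroupOfForm (galAdicCompletionMap (L := L) (IsCMField.complexConj L) hw) ((StdForm.antidiagonal 3).over (w.1.adicCompletion L)))) :
            GL (Fin 3) (w.1.adicCompletion L)) =
        ((localNonsplitEquiv (IsCMField.complexConj L) (Matrix.of fun i j : Fin 3 => if i.val + j.val + 1 = 3 then (1 : L) else 0)
            (IsCMField.complexConj_ne_one L) w hw g).val : GL (Fin 3) (w.1.adicCompletion L)))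
    -- the literal `H`-frame with (MAT₂) (★ (G4) §5 `exists_socketFrame_two`)
    (e₂ : (cmDatum L 2 (Matrix.of fun i j : Fin 2 => if i.val + j.val + 1 = 2 then (1 : L) else 0)).Local v ≃ₜ*
      ↥(unitaryGroupOfForm (galAdicCompletionMap (L := L) (IsCMField.complexConj L) hw) ((StdForm.antidiagonal 2).over (w.1.adicCompletion L))))
    (hmat₂ : ∀ g : (cmDatum L 2 (Matrix.of fun i j : Fin 2 => if i.val + j.val + 1 = 2 then (1 : L) else 0)).Local v,
      ((e₂ g : ↥(unitaryGroupOfForm (galAdicCompletionMap (L := L) (IsCMField.complexConj L) hw) ((StdForm.antidiagonal 2).over (w.1.adicCompletion L)))) :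
          GL (Fin 2) (w.1.adicCompletion L)) =
        ((localNonsplitEquiv (IsCMField.complexConj L) (Matrix.of fun i j : Fin 2 => if i.val + j.val + 1 = 2 then (1 : L) else 0)
            (IsCMField.complexConj_ne_one L) w hw g).val : GL (Fin 2) (w.1.adicCompletion L))) :
    -- ⊢ the `hHYP` binder of ★ (A) `heckeFLAtFrame_of_cells` (per-place measures), the cell = C3's first disjunct
    ∀ (mH : OrbitalMeasureFamily ((cmDatum L 2 (Matrix.of fun i j : Fin 2 => if i.val + j.val + 1 = 2 then (1 : L) else 0)).Local v ×
        (cmDatum L 1 (Matrix.of fun i j : Fin 1 => if i.val + j.val + 1 = 1 then (1 : L) else 0)).Local v))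
      (mG : OrbitalMeasureFamily ((cmDatum L 3 H').Local v)),
      mH.IsCanonical (IsLocalGRegular L v) νH →
        mG.IsCanonical (fun γ => IsRegularElt (γ.val : GL (Fin 3) (UnitaryGroup.LocalRing L v))) νG →
          ∀ (φ : heckeAlgebra ℂ ↥(unitaryGroupOfForm (galAdicCompletionMap (L := L) (IsCMField.complexConj L) hw) ((StdForm.antidiagonal 3).over (w.1.adicCompletion L)))
              (unitaryInt (galAdicCompletionMap (L := L) (IsCMField.complexConj L) hw) ((StdForm.antidiagonal 3).over (w.1.adicCompletion L))))
            (φH : heckeAlgebra ℂ ↥(unitaryGroupOfForm (galAdicCompletionMap (L := L) (IsCMField.complexConj L) hw) ((StdForm.antidiagonal 2).over (w.1.adicCompletion L)))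
              (unitaryInt (galAdicCompletionMap (L := L) (IsCMField.complexConj L) hw) ((StdForm.antidiagonal 2).over (w.1.adicCompletion L)))),
            (∀ z : ℂˣ,
              unitaryHeckeEigencharacterAdic (IsCMField.complexConj L) (IsCMField.complexConj_ne_one L) v w hw hv ![z, 1] φH =
                unitaryHeckeEigencharacterAdic (IsCMField.complexConj L) (IsCMField.complexConj_ne_one L) v w hw hv ![-z, 1, 1] φ) →
              ∀ γH : ((cmDatum L 2 (Matrix.of fun i j : Fin 2 => if i.val + j.val + 1 = 2 then (1 : L) else 0)).Local v ×
                  (cmDatum L 1 (Matrix.of fun i j : Fin 1 => if i.val + j.val + 1 = 1 then (1 : L) else 0)).Local v),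
                IsLocalGRegular L v γH →
                  (∃ (h : (cmDatum L 2 (Matrix.of fun i j : Fin 2 => if i.val + j.val + 1 = 2 then (1 : L) else 0)).Local v)
                      (d' : Fin 2 → (UnitaryGroup.LocalRing L v)ˣ),
                      glDiagonal 2 (UnitaryGroup.LocalRing L v) d' = ((h * γH.1 * h⁻¹ :
                        (cmDatum L 2 (Matrix.of fun i j : Fin 2 => if i.val + j.val + 1 = 2 then (1 : L) else 0)).Local v).val : GL (Fin 2) (UnitaryGroup.LocalRing L v))) →
                  stableOrbitalIntegralRel (IsLocalStablyConjH L v) mH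
                      (fun h : ((cmDatum L 2 (Matrix.of fun i j : Fin 2 => if i.val + j.val + 1 = 2 then (1 : L) else 0)).Local v ×
                          (cmDatum L 1 (Matrix.of fun i j : Fin 1 => if i.val + j.val + 1 = 1 then (1 : L) else 0)).Local v) =>
                        (heckeAlgebra.toVector (unitaryInt (galAdicCompletionMap (L := L) (IsCMField.complexConj L) hw) ((StdForm.antidiagonal 2).over (w.1.adicCompletion L))) φH).coeff
                          ((e₂ h.1 : ↥(unitaryGroupOfForm (galAdicCompletionMap (L := L) (IsCMField.complexConj L) hw) ((StdForm.antidiagonal 2).over (w.1.adicCompletion L)))) :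
                            ↥(unitaryGroupOfForm (galAdicCompletionMap (L := L) (IsCMField.complexConj L) hw) ((StdForm.antidiagonal 2).over (w.1.adicCompletion L))) ⧸
                              unitaryInt (galAdicCompletionMap (L := L) (IsCMField.complexConj L) hw) ((StdForm.antidiagonal 2).over (w.1.adicCompletion L))))
                      γH =
                    ∑ᶠ c : ConjClasses ((cmDatum L 3 H').Local v),
                      ((finExplicitCollection L H' μ (finExplicitDelta_conj_left_all L H' μ) (finExplicitDelta_conj_right_all L H' μ)) v).Δ γH (Quotient.out c) *
                        classOrbitalIntegral mG
                          (fun g : (cmDatum L 3 H').Local v =>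
                            (heckeAlgebra.toVector (unitaryInt (galAdicCompletionMap (L := L) (IsCMField.complexConj L) hw) ((StdForm.antidiagonal 3).over (w.1.adicCompletion L))) φ).coeff
                              ((eG g : ↥(unitaryGroupOfForm (galAdicCompletionMap (L := L) (IsCMField.complexConj L) hw) ((StdForm.antidiagonal 3).over (w.1.adicCompletion L)))) :
                                ↥(unitaryGroupOfForm (galAdicCompletionMap (L := L) (IsCMField.complexConj L) hw) ((StdForm.antidiagonal 3).over (w.1.adicCompletion L))) ⧸
                                  unitaryInt (galAdicCompletionMap (L := L) (IsCMField.complexConj L) hw) ((StdForm.antidiagonal 3).over (w.1.adicCompletion L)))) c := by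
  intro mH mG hmH hmG φ φH hgraph γH hreg hcell
  haveI : Algebra.IsQuadraticExtension ↥(maximalRealSubfield L) L := IsCMField.isQuadraticExtension L
  -- the cell datum: `γ_H₁ := y γ_H y⁻¹` with `y = (h, 1)` lies on the Levi stratum
  have hcell' := hcell
  obtain ⟨h, d', hd⟩ := hcell'
  have hyd' : glDiagonal 2 (UnitaryGroup.LocalRing L v) d' =
      ((((h, 1) : ((cmDatum L 2 (Matrix.of fun i j : Fin 2 => if i.val + j.val + 1 = 2 then (1 : L) else 0)).Local v ×
          (cmDatum L 1 (Matrix.of fun i j : Fin 1 => if i.val + j.val + 1 = 1 then (1 : L) else 0)).Local v)) * γH * (h, 1)⁻¹).1.val :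
        GL (Fin 2) (UnitaryGroup.LocalRing L v)) := hd
  have hconj : IsConj γH (((h, 1) : ((cmDatum L 2 (Matrix.of fun i j : Fin 2 => if i.val + j.val + 1 = 2 then (1 : L) else 0)).Local v ×
      (cmDatum L 1 (Matrix.of fun i j : Fin 1 => if i.val + j.val + 1 = 1 then (1 : L) else 0)).Local v)) * γH * (h, 1)⁻¹) := isConj_iff.2 ⟨(h, 1), rfl⟩
  have hst := (isLocalStablyConjH_of_isConj_and_conj L γH).1 _ hconj
  have hreg₁ := (isLocalGRegular_conj_iff L ((h, 1) : ((cmDatum L 2 (Matrix.of fun i j : Fin 2 => if i.val + j.val + 1 = 2 then (1 : L) else 0)).Local v ×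
      (cmDatum L 1 (Matrix.of fun i j : Fin 1 => if i.val + j.val + 1 = 1 then (1 : L) else 0)).Local v)) γH).2 hreg
  -- the Levi units off `G`-regularity, `m := ord_w d′₀`
  obtain ⟨ha, hb, h12⟩ := isUnit_levi_of_isLocalGRegular_of_nonsplit L w hw hyd' hreg₁
  have hd0 : ((d' 0 : UnitaryGroup.LocalRing L v) w) ≠ 0 := ((d' 0).isUnit.map (Pi.evalRingHom (fun w' : PlacesOver L v => w'.1.adicCompletion L) w)).ne_zero
  obtain ⟨m₀, hm₀⟩ := exists_v_eq_exp hd0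
  have hm : Valued.v ((d' 0 : UnitaryGroup.LocalRing L v) w) = WithZero.exp (-(-m₀)) := by rw [neg_neg]; exact hm₀
  -- `det H′ ∈ Lˣ` from the guard at `w`; hermitian in the `complexConj` spelling
  have hH'd : IsUnit H'.det := by
    have hdt : (placeForm H' w.1).det = algebraMap L (w.1.adicCompletion L) H'.det := by
      rw [placeForm, RingHom.map_det, RingHom.mapMatrix_apply]
    have hu := (Matrix.isUnit_iff_isUnit_det _).1 hH'w
    rw [hdt] at hu
    exact isUnit_iff_ne_zero.2 fun h0 => hu.ne_zero (by rw [h0, map_zero])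
  have hH'c : (H'.map (IsCMField.complexConj L))ᵀ = H' := by rw [← map_cmConjRingHom_eq_map_complexConj]; exact hH'
  -- ★ (B2d)-AT-PLACE at `γ_H₁`, with `eA₃ := congr ≫ eG` (so that `heA₃` is (MAT)) and `eA₂ := e₂`
  have key := stableOrbitalIntegralRel_coeff_toVector_eq_finsum_finExplicitDelta_of_levi_atPlace L H' hH'c hH'd w hw hv hH'w hH'i μ hμ hμω
    (finExplicitDelta_conj_left_all L H' μ) (finExplicitDelta_conj_right_all L H' μ) νG hmG hνG νH hmH hνH T₀ ha₀ hT₀ hlev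
    (K₃ := cmLocalIntegralLevel L 3 (Matrix.of fun i j : Fin 3 => if i.val + j.val + 1 = 3 then (1 : L) else 0) v) (fun _ => Iff.rfl)
    (cmLocalIntegralLevel L 2 (Matrix.of fun i j : Fin 2 => if i.val + j.val + 1 = 2 then (1 : L) else 0) v) rfl
    ((cmDatumLocalCongr L v T₀ ha₀ hT₀).trans eG) (fun g => hmat g) e₂ hmat₂
    (unramifiedLocalConjDatum_localConjUniformizer (IsCMField.complexConj L) (IsCMField.complexConj_ne_one L) v w hw hv) φ φH hgraph hyd' hreg₁ ha hb h12 hm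
  -- `congr⁻¹ ≫ (congr ≫ eG) = eG` on the `G`-test function
  have hfun : (fun g : (cmDatum L 3 H').Local v =>
      (heckeAlgebra.toVector (unitaryInt (galAdicCompletionMap (L := L) (IsCMField.complexConj L) hw) ((StdForm.antidiagonal 3).over (w.1.adicCompletion L))) φ).coeff
        (((((cmDatumLocalCongr L v T₀ ha₀ hT₀).symm.trans ((cmDatumLocalCongr L v T₀ ha₀ hT₀).trans eG)) g :
            ↥(unitaryGroupOfForm (galAdicCompletionMap (L := L) (IsCMField.complexConj L) hw) ((StdForm.antidiagonal 3).over (w.1.adicCompletion L)))) :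
          ↥(unitaryGroupOfForm (galAdicCompletionMap (L := L) (IsCMField.complexConj L) hw) ((StdForm.antidiagonal 3).over (w.1.adicCompletion L))) ⧸
            unitaryInt (galAdicCompletionMap (L := L) (IsCMField.complexConj L) hw) ((StdForm.antidiagonal 3).over (w.1.adicCompletion L))))) =
      (fun g : (cmDatum L 3 H').Local v =>
        (heckeAlgebra.toVector (unitaryInt (galAdicCompletionMap (L := L) (IsCMField.complexConj L) hw) ((StdForm.antidiagonal 3).over (w.1.adicCompletion L))) φ).coeff
          ((eG g : ↥(unitaryGroupOfForm (galAdicCompletionMap (L := L) (IsCMField.complexConj L) hw) ((StdForm.antidiagonal 3).over (w.1.adicCompletion L)))) :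
            ↥(unitaryGroupOfForm (galAdicCompletionMap (L := L) (IsCMField.complexConj L) hw) ((StdForm.antidiagonal 3).over (w.1.adicCompletion L))) ⧸
              unitaryInt (galAdicCompletionMap (L := L) (IsCMField.complexConj L) hw) ((StdForm.antidiagonal 3).over (w.1.adicCompletion L)))) := by
    -- (pointwise on the group, then `congrArg` — no rewriting inside the instance-laden test function)
    have hpt : ∀ g : (cmDatum L 3 H').Local v,
        ((cmDatumLocalCongr L v T₀ ha₀ hT₀).symm.trans ((cmDatumLocalCongr L v T₀ ha₀ hT₀).trans eG)) g = eG g := fun g => by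
      rw [ContinuousMulEquiv.trans_apply, ContinuousMulEquiv.trans_apply, ContinuousMulEquiv.apply_symm_apply]
    exact funext fun g => congrArg (fun x : ↥(unitaryGroupOfForm (galAdicCompletionMap (L := L) (IsCMField.complexConj L) hw) ((StdForm.antidiagonal 3).over (w.1.adicCompletion L))) =>
      (heckeAlgebra.toVector (unitaryInt (galAdicCompletionMap (L := L) (IsCMField.complexConj L) hw) ((StdForm.antidiagonal 3).over (w.1.adicCompletion L))) φ).coeff
        (x : ↥(unitaryGroupOfForm (galAdicCompletionMap (L := L) (IsCMField.complexConj L) hw) ((StdForm.antidiagonal 3).over (w.1.adicCompletion L))) ⧸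
          unitaryInt (galAdicCompletionMap (L := L) (IsCMField.complexConj L) hw) ((StdForm.antidiagonal 3).over (w.1.adicCompletion L)))) (hpt g)
  -- transport the clause from `γ_H₁` back to `γ_H` (both sides are stable class functions)
  exact (stableOrbitalIntegralRel_eq_finsum_finExplicitDelta_iff_of_isLocalStablyConjH L H' μ
    (finExplicitDelta_conj_left_all L H' μ) (finExplicitDelta_conj_right_all L H' μ) mH mG _ _ hst).2
    (key.trans (congrArg (fun F => ∑ᶠ c : ConjClasses ((cmDatum L 3 H').Local v),
      ((finExplicitCollection L H' μ (finExplicitDelta_conj_left_all L H' μ) (finExplicitDelta_conj_right_all L H' μ)) v).Δ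
        (((h, 1) : ((cmDatum L 2 (Matrix.of fun i j : Fin 2 => if i.val + j.val + 1 = 2 then (1 : L) else 0)).Local v ×
          (cmDatum L 1 (Matrix.of fun i j : Fin 1 => if i.val + j.val + 1 = 1 then (1 : L) else 0)).Local v)) * γH * (h, 1)⁻¹) (Quotient.out c) *
        classOrbitalIntegral mG F c) hfun))

end HypCell

end Summit.HodgeConjecture.HodgeConjecture.R90.S6

end
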